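import Mathlib
import Summits.NavierStokesRegularity.FluidComputer.TransportSobolevSelfAdvection
import HarnessLib

/-!
# The transport term on the lattice Sobolev scale, VIII: the `L²` energy inequality of the perturbation field (instab g19, cell `ns-blowup`, 2026-08-27)

HONEST FRAMING (human ruling D-0035): nothing here is a claim about Navier–Stokes blow-up.
WHAT THIS IS NOT: not NS evidence — a lattice (`ℤ^d`, Fourier-side) inequality for rapidly decreasing
coefficient families; no flow, set `W` or certificate is constructed.

PURPOSE. The order-`σ` energy inequality of part VII (`TransportSobolevSelfAdvection.two_re_pairing_field_le`)
needs `σ ≥ 1` (commutators). At order ZERO there is no commutator at all: both transport pairings are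
purely imaginary (`TransportSkewLattice.re_pairing_transport_eq_zero`), dissipation is exact and
non-positive, and only the stretching term survives:

  `2 Re ⟨P(linCoeff ν Uv π u + bilCoeff π u u), u⟩ ≤ 2 · (card d · 2π · A₁(Uv)) · ‖u‖₀²`   (`two_re_pairing_field_le_zero`).

This LINEAR differential inequality is the a-priori `L²` bound that makes every Galerkin level of the
model exist globally (finite-dimensional ODE with an energy estimate; tree
`Literature.Analysis.ODE.GlobalExistence.exists_solution_of_apriori_bound`) — the «existence» half of
the last residence input of the R-β chain (`TransportGalerkinEmergenceLevels`).
-/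

noncomputable section

open scoped ENNReal NNReal ComplexConjugate InnerProductSpace

namespace Summit.NavierStokesRegularity.FluidComputer.TransportSobolevEnergyZero

open Complex
open Literature.Analysis.FunctionSpaces Literature.Analysis.FunctionSpaces.Lattice
open Literature.Analysis.FunctionSpaces.Torus
open Summit.NavierStokesRegularity.FluidComputer.TransportCommutatorLattice
open Summit.NavierStokesRegularity.FluidComputer.TransportSkewLattice
open Summit.NavierStokesRegularity.FluidComputer.TransportSobolevEnergy
open Summit.NavierStokesRegularity.FluidComputer.TransportSobolevSelfAdvection
open Summit.NavierStokesRegularity.FluidComputer.TransportGalerkin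
open Summit.NavierStokesRegularity.FluidComputer.TransportGalerkinRapid

variable {d : Type*} [Fintype d]
variable {V : Type*} [NormedAddCommGroup V] [InnerProductSpace ℂ V] [CompleteSpace V]

omit [CompleteSpace V] in
/-- Summability of the pairing of two rapidly decreasing families. -/
theorem summable_inner_rapid {f u : (d → ℤ) → V} (hf : RapidDecay f) (hu : RapidDecay u) :
    Summable fun k => ⟪f k, u k⟫_ℂ :=
  summable_inner (eNormSq_lt_top_of_rapidDecay hf 0)
    (by rw [neg_zero]; exact eNormSq_lt_top_of_rapidDecay hu 0)

/-- **The `L²` energy inequality of the perturbation field** (order zero; `ν ≥ 0`). Host: `Uv`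
rapidly decreasing, real and divergence-free through `π` (`‖π_j‖ ≤ 1`); Leray symbol: a modewise
self-adjoint family `P` fixing `u`; unknown: `u` rapidly decreasing, real and divergence-free through
`π`. Then

  `2 Re ⟨P(linCoeff ν Uv π u + bilCoeff π u u), u⟩ ≤ 2 (card d · 2π · A₁(Uv)) ‖u‖₀²`,
  `A₁(Uv) = ∑_l ⟨l⟩ ‖Uv l‖`:

dissipation `νRe⟨Δu,u⟩ = −ν(2π)²(‖u‖₁² − ‖u‖₀²) ≤ 0`, advection by the host and self-advection purely
imaginary (skewness), stretching bounded by part VI §4 at `s = 0`. Along a Galerkin level this is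
`d/dt ‖û‖₀² ≤ 2H₀‖û‖₀²`: no level of the model blows up. -/
theorem two_re_pairing_field_le_zero {ν : ℝ} (hν : 0 ≤ ν) {Uv : (d → ℤ) → V} (hUv : RapidDecay Uv)
    (π : d → (V →L[ℂ] ℂ)) (hπ : ∀ j, ‖π j‖ ≤ 1)
    (hUreal : ∀ j p, π j (Uv (-p)) = conj (π j (Uv p)))
    (hUdiv : ∑ j, freqDeriv j (fun p => π j (Uv p)) = 0)
    (P : (d → ℤ) → (V →L[ℂ] V)) (hPsa : ∀ k, IsSelfAdjoint (P k))
    {u : (d → ℤ) → V} (hu : RapidDecay u) (hfix : ∀ k, P k (u k) = u k)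
    (hreal : ∀ j p, π j (u (-p)) = conj (π j (u p)))
    (hdiv : ∑ j, freqDeriv j (fun p => π j (u p)) = 0) :
    2 * (pairing (fun k => P k (linCoeff ν Uv π u k + bilCoeff π u u k)) u).re ≤
      2 * (((Fintype.card d : ℝ) * (2 * Real.pi)) *
        (∑' l, ENNReal.ofReal (sobolevWeight 1 l) * ‖Uv l‖ₑ).toReal) * (eNormSq 0 u).toReal := by
  -- names
  set L := ∑ j, freqDeriv j (freqDeriv j u) with hL
  set T₁ := ∑ j, conv (scal (fun p => π j (Uv p)) : (d → ℤ) → (V →L[ℂ] V)) (freqDeriv j u) with hT₁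
  set T₂ := ∑ j, conv (scal (fun p => π j (u p)) : (d → ℤ) → (V →L[ℂ] V)) (freqDeriv j Uv) with hT₂
  set T₃ := ∑ j, conv (scal (fun p => π j (u p)) : (d → ℤ) → (V →L[ℂ] V)) (freqDeriv j u) with hT₃
  have hLr : RapidDecay L := RapidDecay.finset_sum _ fun j _ => (hu.freqDeriv' j).freqDeriv' j
  have hT₁r : RapidDecay T₁ :=
    RapidDecay.finset_sum _ fun j _ => (hu.freqDeriv' j).conv_right (hUv.comp_apply (π j)).scal
  have hT₂r : RapidDecay T₂ :=
    RapidDecay.finset_sum _ fun j _ => (hUv.freqDeriv' j).conv_right (hu.comp_apply (π j)).scal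
  have hT₃r : RapidDecay T₃ :=
    RapidDecay.finset_sum _ fun j _ => (hu.freqDeriv' j).conv_right (hu.comp_apply (π j)).scal
  -- (a) drop the Leray symbol
  set f : (d → ℤ) → V := fun k => linCoeff ν Uv π u k + bilCoeff π u u k with hf
  have hdrop : pairing (fun k => P k (f k)) u = pairing f u :=
    pairing_apply_eq_of_isSelfAdjoint P hPsa _ _ hfix
  -- (b) split the field
  have hfsplit : f = (ν : ℂ) • L - T₁ - T₂ - T₃ := by
    funext k
    simp only [hf, linCoeff_eq, bilCoeff_eq, Pi.sub_apply, Pi.smul_apply, Pi.neg_apply, hL, hT₁, hT₂, hT₃]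
    abel
  have hsL : Summable fun k => ⟪((ν : ℂ) • L) k, u k⟫_ℂ := by
    refine ((summable_inner_rapid hLr hu).const_smul (conj (ν : ℂ))).congr fun k => ?_
    rw [Pi.smul_apply, inner_smul_left, smul_eq_mul]
  have hs₁ := summable_inner_rapid hT₁r hu
  have hs₂ := summable_inner_rapid hT₂r hu
  have hs₃ := summable_inner_rapid hT₃r hu
  have hpsplit : pairing f u =
      (ν : ℂ) * pairing L u - pairing T₁ u - pairing T₂ u - pairing T₃ u := by
    have hsub1 : Summable fun k => ⟪((ν : ℂ) • L - T₁) k, u k⟫_ℂ := by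
      refine (hsL.sub hs₁).congr fun k => ?_; simp only [Pi.sub_apply, inner_sub_left]
    have hsub2 : Summable fun k => ⟪((ν : ℂ) • L - T₁ - T₂) k, u k⟫_ℂ := by
      refine (hsub1.sub hs₂).congr fun k => ?_; simp only [Pi.sub_apply, inner_sub_left]
    rw [hfsplit, pairing_sub_left hsub2 hs₃, pairing_sub_left hsub1 hs₂, pairing_sub_left hsL hs₁,
      pairing_smul_left, Complex.conj_ofReal]
  -- (c) the four estimates at order zero
  have hu1 : eNormSq 1 u < ∞ := eNormSq_lt_top_of_rapidDecay hu _
  have hu0 : eNormSq 0 u < ∞ := eNormSq_lt_top_of_rapidDecay hu _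
  have hdiss : (pairing L u).re = -((2 * Real.pi) ^ 2 * ((eNormSq 1 u).toReal - (eNormSq 0 u).toReal)) := by
    have h := re_pairing_wmul_laplacian_eq (0 : ℝ) (u := u) (by rw [zero_add]; exact hu1)
    rwa [wmul_zero, wmul_zero, zero_add] at h
  have hmono : (eNormSq 0 u).toReal ≤ (eNormSq 1 u).toReal :=
    ENNReal.toReal_mono hu1.ne (eNormSq_mono zero_le_one u)
  have h₁ : (pairing T₁ u).re = 0 :=
    re_pairing_transport_eq_zero (fun j p => π j (Uv p)) (fun j => hUv.comp_apply (π j)) hUreal hUdiv hu1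
  have h₃ : (pairing T₃ u).re = 0 :=
    re_pairing_transport_eq_zero (fun j p => π j (u p)) (fun j => hu.comp_apply (π j)) hreal hdiv hu1
  have h₂ : |(pairing T₂ u).re| ≤ ((Fintype.card d : ℝ) * (2 * Real.pi)) *
      (∑' l, ENNReal.ofReal (sobolevWeight 1 l) * ‖Uv l‖ₑ).toReal * (eNormSq 0 u).toReal := by
    have h := abs_re_pairing_wmul_stretching_le (le_refl (0 : ℝ)) π hπ Uv
      (by rw [zero_add]; exact tsum_weight_mul_enorm_lt_top hUv 1) hu0
    rw [wmul_zero, wmul_zero, zero_add, zero_div, Real.rpow_zero, one_mul] at h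
    exact h
  -- assemble
  rw [hdrop, hpsplit]
  simp only [Complex.sub_re, Complex.mul_re, Complex.ofReal_re, Complex.ofReal_im, zero_mul,
    sub_zero, hdiss, h₁, h₃]
  have e₂ := (abs_le.1 h₂).1
  have hνD : 0 ≤ ν * ((2 * Real.pi) ^ 2 * ((eNormSq 1 u).toReal - (eNormSq 0 u).toReal)) := by
    have : 0 ≤ (2 * Real.pi) ^ 2 * ((eNormSq 1 u).toReal - (eNormSq 0 u).toReal) :=
      mul_nonneg (by positivity) (sub_nonneg.2 hmono)
    exact mul_nonneg hν this
  nlinarith [e₂, hνD]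

end Summit.NavierStokesRegularity.FluidComputer.TransportSobolevEnergyZero

end
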